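import Summits.CriticalPhenomena.PercolationContinuityZ3.Theorems.PercNearOneGluingNoHeavyPcintKingCovering
import Literature.Probability.Percolation.SiteMatchingPairInequality
import Literature.Probability.Percolation.CrossoverCoupling
import HarnessLib

/-!
# PCINT lane, the KING ROUTE for the site upper cells: `p_c^site(ℤ⁴) ≤ 1 - p_c^site(ℤ²)`, and the
# rows `ℤ⁴ < 0.444`, `ℤ⁵ ≤ 0.425`, `ℤ⁸ ≤ 0.2544` from any proof of `p_c^site(ℤ²) > 0.556`

Cell `prim-pcint`, seat `prim-pcint-1` (gen 9); memo `run/shared/lean/prim/pcint/KING-ROUTE.md`.  Theorems only,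
no new facts, no `sorry`.

The two kernel inputs landed by this seat,

* `KingCover.siteCriticalProb_Z4_le_star` (`…PcintKingCovering.lean`, p325504): `p_c^site(ℤ⁴) ≤ p_c^site(ℤ²∗)`
  (`ℤ⁴` covers the matching lattice `ℤ²∗ = zdStarGraph`; Lyons–Peres Thm. 6.47, site version), and
* `siteCriticalProb_star_le_one_sub` (`Literature/…/SiteMatchingPairInequality.lean`, p326117):
  `p_c^site(ℤ²∗) ≤ 1 - p_c^site(ℤ²)` (Russo 1981 / Kesten 1982 Cor. 3.1, the half needed here, by
  Duminil-Copin–Tassion sharpness + the matching-pair crossing duality),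

combine to the STRUCTURAL bound

* `siteCriticalProb_Z4_le_one_sub_Z2`: **`p_c^site(ℤ⁴) ≤ 1 - p_c^site(ℤ²)`** (and `siteCriticalProb_zd_le_one_sub_Z2`
  for every `d ≥ 4`): every LOWER bound `b ≤ p_c^site(ℤ²)` for the square lattice is an UPPER bound
  `1 - b` for `ℤ⁴` (`siteCriticalProb_Z4_le_of_Z2_ge`).

With the best lower bound in print, van den Berg–Ermakov 1996 (Random Struct. Alg. 8, Thm. 1.1:
`p_c^site(ℤ²) > 0.556`; named fact `VandenBergErmakov1996SquareSite` of
`Literature/…/SquareSiteVdBergErmakov.lean`, NOT proved in the tree — the theorems below take the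
inequality itself as a hypothesis `h`), this gives the CONDITIONAL rows

* `siteCriticalProb_Z4_lt_of_Z2_gt_0556`: **`p_c^site(ℤ⁴) < 0.444`**;
* `siteCriticalProb_Z5_le_of_Z2_gt_0556`: **`p_c^site(ℤ⁵) ≤ 0.425`** (Gomes–Pereira–Sanchis Prop. 4 crossover from
  `d = 4`, `GPSCrossover.siteCriticalProb_zd_succ_le_of_crossover`, `q = 0.076`, `7` copies, detours `≤ 5`);
* `siteCriticalProb_Z8_le_of_Z2_gt_0556`: **`p_c^site(ℤ⁸) ≤ 0.2544`** (GPS Lemma 2, `k = 4`, `m = 2`: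
  `1 - √0.556 = 0.25435`),

to be compared with the unconditional kernel cells `0.4685 / 0.4477 / 0.271` (`CrossoverCoupling.lean`) and
the cells conditional on Wierman 1995 (`p_c^site(ℤ²) ≤ 0.679492`), `0.4339 / 0.4153 / 0.2476`
(`SquareSiteWierman.lean`).  A kernel proof of any `b ≤ p_c^site(ℤ²)` with `b > 0.5315` improves the
unconditional cells; `b > 0.5661` would pass the Wierman-conditional ones.
-/

noncomputable section

namespace Summit.CriticalPhenomena.PercolationContinuityZ3.Theorems.Pcint

open Literature.Probability.Percolation Literature.Probability.LatticeModels

namespace KingCover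

/-- **`p_c^site(ℤ⁴) ≤ 1 - p_c^site(ℤ²)`**: the covering `ℤ⁴ → ℤ²∗` and the matching-pair inequality
`p_c^site(ℤ²∗) + p_c^site(ℤ²) ≤ 1`. -/
theorem siteCriticalProb_Z4_le_one_sub_Z2 :
    siteCriticalProb (zdGraph 4) (0 : Site 4) ≤ 1 - siteCriticalProb (zdGraph 2) (0 : Site 2) :=
  siteCriticalProb_Z4_le_star.trans siteCriticalProb_star_le_one_sub

/-- **`p_c^site(ℤ^d) ≤ 1 - p_c^site(ℤ²)` for every `d ≥ 4`.** -/
theorem siteCriticalProb_zd_le_one_sub_Z2 {d : ℕ} (hd : 4 ≤ d) :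
    siteCriticalProb (zdGraph d) (0 : Site d) ≤ 1 - siteCriticalProb (zdGraph 2) (0 : Site 2) :=
  (siteCriticalProb_zd_le_star hd).trans siteCriticalProb_star_le_one_sub

/-- **Lower bounds for `ℤ²` are upper bounds for `ℤ⁴`**: `b ≤ p_c^site(ℤ²)` implies `p_c^site(ℤ⁴) ≤ 1 - b`. -/
theorem siteCriticalProb_Z4_le_of_Z2_ge {b : ℝ} (hb : b ≤ siteCriticalProb (zdGraph 2) (0 : Site 2)) :
    siteCriticalProb (zdGraph 4) (0 : Site 4) ≤ 1 - b :=
  siteCriticalProb_Z4_le_one_sub_Z2.trans (by linarith)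

/-- **`p_c^site(ℤ⁴) < 0.444` if `p_c^site(ℤ²) > 0.556`** (van den Berg–Ermakov 1996, Thm. 1.1, taken as the
hypothesis `h`; named fact `VandenBergErmakov1996SquareSite`). -/
theorem siteCriticalProb_Z4_lt_of_Z2_gt_0556 (h : (0.556 : ℝ) < siteCriticalProb (zdGraph 2) (0 : Site 2)) :
    siteCriticalProb (zdGraph 4) (0 : Site 4) < 0.444 := by
  have := siteCriticalProb_Z4_le_one_sub_Z2
  linarith

/-- **`p_c^site(ℤ⁵) ≤ 0.425` if `p_c^site(ℤ²) > 0.556`**: Gomes–Pereira–Sanchis's crossover coupling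
(Prop. 4 / Thm. 3(3)) from `p_c^site(ℤ⁴) < 0.444`, with `q = 0.076`, `2d - 1 = 7` copies and detours of
height `≤ 5` (gadget probability `0.44437 > 0.444`, bound `1 - 0.924^7 = 0.42495…`). -/
theorem siteCriticalProb_Z5_le_of_Z2_gt_0556 (h : (0.556 : ℝ) < siteCriticalProb (zdGraph 2) (0 : Site 2)) :
    siteCriticalProb (zdGraph 5) (0 : Site 5) ≤ 0.425 := by
  have hq : (0.076 : ℝ) ∈ unitInterval := ⟨by norm_num, by norm_num⟩
  have hg : (0.444 : ℝ) < GPSCrossover.gadgetProb (0.076 : ℝ) 5 (2 * 4 - 1) := by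
    rw [GPSCrossover.gadgetProb]
    norm_num [Finset.sum_range_succ]
  have := GPSCrossover.siteCriticalProb_zd_succ_le_of_crossover (d := 4) (by norm_num) 5 ⟨0.076, hq⟩
    ((siteCriticalProb_Z4_lt_of_Z2_gt_0556 h).trans hg)
  refine this.trans ?_
  norm_num

/-- **`p_c^site(ℤ^d) ≤ 0.425` for every `d ≥ 5`, if `p_c^site(ℤ²) > 0.556`.** -/
theorem siteCriticalProb_zd_le_of_Z2_gt_0556_of_five_le (h : (0.556 : ℝ) < siteCriticalProb (zdGraph 2) (0 : Site 2))
    {d : ℕ} (hd : 5 ≤ d) : siteCriticalProb (zdGraph d) (0 : Site d) ≤ 0.425 :=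
  (AxisGrouping.siteCriticalProb_zd_anti hd).trans (siteCriticalProb_Z5_le_of_Z2_gt_0556 h)

/-- **`p_c^site(ℤ⁸) ≤ 0.2544` if `p_c^site(ℤ²) > 0.556`**: Gomes–Pereira–Sanchis's Lemma 2 with `k = 4`,
`m = 2` (`AxisGrouping.siteCriticalProb_zd_mul_le_real`) from `p_c^site(ℤ⁴) < 0.444`:
`1 - √(1 - 0.444) = 0.25435…`. -/
theorem siteCriticalProb_Z8_le_of_Z2_gt_0556 (h : (0.556 : ℝ) < siteCriticalProb (zdGraph 2) (0 : Site 2)) :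
    siteCriticalProb (zdGraph 8) (0 : Site 8) ≤ 0.2544 := by
  have h4 := siteCriticalProb_Z4_lt_of_Z2_gt_0556 h
  have h' := AxisGrouping.siteCriticalProb_zd_mul_le_real (k := 4) (m := 2) (t₀ := 0.2544) (by norm_num)
    fun t ht ht1 => by
      have h0 : 0 ≤ 1 - t := by linarith
      have h2 : (1 - t) ^ 2 < (0.7456 : ℝ) ^ 2 := pow_lt_pow_left₀ (by linarith) h0 (by norm_num)
      norm_num at h2
      linarith
  exact h'

/-- **`p_c^site(ℤ^d) ≤ 0.2544` for every `d ≥ 8`, if `p_c^site(ℤ²) > 0.556`.** -/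
theorem siteCriticalProb_zd_le_of_Z2_gt_0556_of_eight_le (h : (0.556 : ℝ) < siteCriticalProb (zdGraph 2) (0 : Site 2))
    {d : ℕ} (hd : 8 ≤ d) : siteCriticalProb (zdGraph d) (0 : Site d) ≤ 0.2544 :=
  (AxisGrouping.siteCriticalProb_zd_anti hd).trans (siteCriticalProb_Z8_le_of_Z2_gt_0556 h)

end KingCover

end Summit.CriticalPhenomena.PercolationContinuityZ3.Theorems.Pcint

end
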